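import Summits.AtomisticToContinuum.HydrodynamicLimit.Theorems.CollisionIsometryCLTAdaptedWeightCLTSACellUICovering

/-!
# Line `sustained-anisotropy-superexp`, stub `stub_cellUI`, file 2: the UNIFORM-INTEGRABILITY INPUT `CellUIBound`

Crux `CollisionIsometryCLT.AdaptedWeightCLT` (stmt-AtomisticToContinuum-14868, rev-12 TIME-LOCAL form), route
`CollisionIsometryCLT`, sub-problem `HydrodynamicLimit`; `--supports`, proves the registered stub `stub_cellUI`:
every admissible block kernel family `φ`, every cell kernel family `ψ` and every `0 < σ < 1/2` satisfy
`CellUIBound φ ψ σ`, i.e. for `N ≥ N₀` and every configuration `z` in the hard-sphere domain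

  `∫ₓ cellA(z, x) dx ≤ K₁ · (N+1)⁻¹ Σ_j (1 + ‖v_j‖⁶)`,   `K₁ = (27C/σ³) · 384 (1 + Kcol)`.

Statics only (`n = N+1`, `φ_i(x) = φ_N(x_i − x) ≥ 0`, `a_i = v_i − cvel_i` does not depend on `x`):

* POINTWISE (`cellA_le`): `|⟨C2, a⊗a⟩| ≤ 2‖a‖²`, `|⟨C3, a^{⊗3}⟩| ≤ ‖a‖³` (`Pointwise.abs_pairT_C2_le/C3_le`) and the
  weighted Cauchy–Schwarz inequality `(Σ φ_i P(a_i))² ≤ c² (Σ φ_i)(Σ φ_i ‖a_i‖^{2r})` (`sq_sum_mul_pairT_le`) give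
  `cellA(x) ≤ (n⁻¹ Σ_i φ_i(x)) · n⁻¹ Σ_i φ_i(x) (36‖a_i‖⁴ + 3‖a_i‖⁶)` (nine stress and three heat-flux entries);
* DENSITY CAP AND INTEGRATION (`integral_cellA_le`): `n⁻¹ Σ_i φ_i(x) ≤ 27C/σ³` on the hard-sphere domain for
  `N ≥ N₀` (`TimeZero.density_cap`) and `∫ₓ φ_i(x) dx = ∫ φ_N = 1` (`PastDamping.integral_comp_sub_left`), so
  `∫ₓ cellA ≤ (27C/σ³) n⁻¹ Σ_i (36‖a_i‖⁴ + 3‖a_i‖⁶)`;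
* VELOCITIES (`sum_moments_le`): `‖a_i‖^p ≤ 2^{p−1}(‖v_i‖^p + ‖cvel_i‖^p)`, the COVERING BOUND of file 1
  `Σ_i ‖cvel_i‖^p ≤ Kcol Σ_j ‖v_j‖^p` (`CellUI.sum_norm_cvel_pow_le`, for `ℓ_N ≤ 1/4`, which holds eventually since
  `ℓ_N (N+1)^{1/6} → 0`, `eventually_ell_le`) and `‖v‖⁴ ≤ 1 + ‖v‖⁶`.
-/

namespace Summit.AtomisticToContinuum.HydrodynamicLimit.Theorems.SustainedAnisotropy

open scoped BigOperators Topology Classical MeasureTheory ENNReal InnerProductSpace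
open Filter Set MeasureTheory
open Literature.Analysis.FluidPDE
open Summit.AtomisticToContinuum.HydrodynamicLimit.Theorems.ContactSourceDuhamel
open Summit.AtomisticToContinuum.HydrodynamicLimit.Theorems.ContactSourceDuhamel.TimeLocal
open Summit.AtomisticToContinuum.HydrodynamicLimit.Theorems.ContactBalance
open Literature.MathematicalPhysics.KineticTheory (hsDiameter localGibbsLaw empiricalDensityField
  empiricalMomentumField)

noncomputable section

namespace CellUI

/-! ## Cauchy–Schwarz over one block -/

/-- WEIGHTED CAUCHY–SCHWARZ for one test: if `|⟨C', y^{⊗r}⟩| ≤ c‖y‖^r`, then for weights `a_i ≥ 0` and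
arbitrary vectors `u_i`, `(Σ a_i ⟨C', u_i^{⊗r}⟩)² ≤ c² (Σ a) Σ a_i (‖u_i‖^r)²`. -/
theorem sq_sum_mul_pairT_le {ι : Type*} (s : Finset ι) {r : ℕ} {C' : Tens r} {c : ℝ}
    (hc : ∀ y, |pairT C' (tpow r y)| ≤ c * ‖y‖ ^ r) {a : ι → ℝ} (ha : ∀ i ∈ s, 0 ≤ a i) (u : ι → V3) :
    (∑ i ∈ s, a i * pairT C' (tpow r (u i))) ^ 2 ≤
      c ^ 2 * (∑ i ∈ s, a i) * ∑ i ∈ s, a i * (‖u i‖ ^ r) ^ 2 := by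
  have h := Finset.sum_sq_le_sum_mul_sum_of_sq_le_mul s (r := fun i => a i * pairT C' (tpow r (u i)))
    (f := a) (g := fun i => a i * (c * ‖u i‖ ^ r) ^ 2) ha
    (fun i hi => mul_nonneg (ha i hi) (sq_nonneg _))
    (fun i hi => by
      have hP := hc (u i)
      have hsq : pairT C' (tpow r (u i)) ^ 2 ≤ (c * ‖u i‖ ^ r) ^ 2 :=
        sq_le_sq' (abs_le.1 hP).1 (abs_le.1 hP).2
      calc (a i * pairT C' (tpow r (u i))) ^ 2 = a i * (a i * pairT C' (tpow r (u i)) ^ 2) := by ring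
        _ ≤ a i * (a i * (c * ‖u i‖ ^ r) ^ 2) :=
          mul_le_mul_of_nonneg_left (mul_le_mul_of_nonneg_left hsq (ha i hi)) (ha i hi))
  have hg : ∑ i ∈ s, a i * (c * ‖u i‖ ^ r) ^ 2 = c ^ 2 * ∑ i ∈ s, a i * (‖u i‖ ^ r) ^ 2 := by
    rw [Finset.mul_sum]
    exact Finset.sum_congr rfl fun i _ => by ring
  calc (∑ i ∈ s, a i * pairT C' (tpow r (u i))) ^ 2
      ≤ (∑ i ∈ s, a i) * ∑ i ∈ s, a i * (c * ‖u i‖ ^ r) ^ 2 := h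
    _ = c ^ 2 * (∑ i ∈ s, a i) * ∑ i ∈ s, a i * (‖u i‖ ^ r) ^ 2 := by rw [hg]; ring

/-! ## The pointwise bound on the cell anisotropy density -/

variable {γ C : ℝ} {φ : ℕ → T3 → ℝ} {N : ℕ}

/-- POINTWISE: with block weights `φ_i(x) ≥ 0` and `a_i = v_i − cvel_i`,
`cellA(x) ≤ ((N+1)⁻¹ Σ_i φ_i(x)) · (N+1)⁻¹ Σ_i φ_i(x) (36‖a_i‖⁴ + 3‖a_i‖⁶)`. -/
theorem cellA_le (hφ0 : ∀ y, 0 ≤ φ N y) (ψ : ℕ → T3 → ℝ) (z : Cfg N) (x : T3) :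
    cellA N φ ψ z x ≤ (((N + 1 : ℕ) : ℝ)⁻¹ * ∑ i, wgtC N φ z x i) *
      (((N + 1 : ℕ) : ℝ)⁻¹ * ∑ i, wgtC N φ z x i *
        (36 * ‖(z i).2 - cvel N ψ z i‖ ^ 4 + 3 * ‖(z i).2 - cvel N ψ z i‖ ^ 6)) := by
  have h0 : ∀ i ∈ (Finset.univ : Finset (Fin (N + 1))), 0 ≤ wgtC N φ z x i := fun i _ => hφ0 _
  set W : ℝ := ∑ i, wgtC N φ z x i with hW
  set M : ℝ := ((N + 1 : ℕ) : ℝ) with hM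
  set E4 : ℝ := ∑ i, wgtC N φ z x i * (‖(z i).2 - cvel N ψ z i‖ ^ 2) ^ 2 with hE4
  set E6 : ℝ := ∑ i, wgtC N φ z x i * (‖(z i).2 - cvel N ψ z i‖ ^ 3) ^ 2 with hE6
  -- the two channels
  have h2 : ∀ j k : Fin 3, pecA 2 N φ ψ z x (C2 j k) ^ 2 ≤ M⁻¹ ^ 2 * (2 ^ 2 * W * E4) := by
    intro j k
    unfold pecA
    rw [mul_pow]
    exact mul_le_mul_of_nonneg_left (sq_sum_mul_pairT_le Finset.univ
      (Pointwise.abs_pairT_C2_le j k) h0 fun i => (z i).2 - cvel N ψ z i) (sq_nonneg _)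
  have h3 : ∀ b : Fin 3, pecA 3 N φ ψ z x (C3 b) ^ 2 ≤ M⁻¹ ^ 2 * (1 ^ 2 * W * E6) := by
    intro b
    unfold pecA
    rw [mul_pow]
    have hc : ∀ y : V3, |pairT (C3 b) (tpow 3 y)| ≤ 1 * ‖y‖ ^ 3 := fun y => by
      rw [one_mul]; exact Pointwise.abs_pairT_C3_le b y
    exact mul_le_mul_of_nonneg_left (sq_sum_mul_pairT_le Finset.univ hc h0
      fun i => (z i).2 - cvel N ψ z i) (sq_nonneg _)
  -- sum over the twelve components
  have hS2 : ∑ j : Fin 3, ∑ k : Fin 3, pecA 2 N φ ψ z x (C2 j k) ^ 2 ≤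
      ∑ _j : Fin 3, ∑ _k : Fin 3, M⁻¹ ^ 2 * (2 ^ 2 * W * E4) :=
    Finset.sum_le_sum fun j _ => Finset.sum_le_sum fun k _ => h2 j k
  have hS3 : ∑ b : Fin 3, pecA 3 N φ ψ z x (C3 b) ^ 2 ≤ ∑ _b : Fin 3, M⁻¹ ^ 2 * (1 ^ 2 * W * E6) :=
    Finset.sum_le_sum fun b _ => h3 b
  simp only [Finset.sum_const, Finset.card_univ, Fintype.card_fin, nsmul_eq_mul, Nat.cast_ofNat] at hS2 hS3
  have hE : ∑ i, wgtC N φ z x i *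
      (36 * ‖(z i).2 - cvel N ψ z i‖ ^ 4 + 3 * ‖(z i).2 - cvel N ψ z i‖ ^ 6) = 36 * E4 + 3 * E6 := by
    rw [hE4, hE6, Finset.mul_sum, Finset.mul_sum, ← Finset.sum_add_distrib]
    exact Finset.sum_congr rfl fun i _ => by ring
  unfold cellA
  calc _ ≤ 3 * (3 * (M⁻¹ ^ 2 * (2 ^ 2 * W * E4))) + 3 * (M⁻¹ ^ 2 * (1 ^ 2 * W * E6)) := add_le_add hS2 hS3
    _ = (M⁻¹ * W) * (M⁻¹ * (36 * E4 + 3 * E6)) := by ring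
    _ = _ := by rw [← hE]

/-! ## The density cap and the integration over the torus -/

/-- INTEGRATED: for `N ≥ N₀(γ)` and `z` in the hard-sphere domain of diameter `hsDiameter σ N`,
`∫ₓ cellA(z, x) dx ≤ (27C/σ³) · (N+1)⁻¹ Σ_i (36‖a_i‖⁴ + 3‖a_i‖⁶)` (density cap inserted pointwise, then
`∫ₓ φ_N(x_i − x) dx = 1`). -/
theorem integral_cellA_le (hadm : AdmissibleKernel γ C φ) (hγ : 0 < γ) (hγ' : γ ≤ 1 / 15) {σ : ℝ}
    (hσ : 0 < σ) (hσ' : σ < 2⁻¹) (ψ : ℕ → T3 → ℝ) :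
    ∃ N₀ : ℕ, ∀ N : ℕ, N₀ ≤ N →
      ∀ z ∈ hardSphereDomain (Torus.geometry (Fin 3)) (N + 1) (hsDiameter σ N),
        ∫ x, cellA N φ ψ z x ≤ 27 * C / σ ^ 3 * (((N + 1 : ℕ) : ℝ)⁻¹ *
          ∑ i, (36 * ‖(z i).2 - cvel N ψ z i‖ ^ 4 + 3 * ‖(z i).2 - cvel N ψ z i‖ ^ 6)) := by
  obtain ⟨N₀, hN₀⟩ := TimeZero.density_cap hadm hγ hγ' hσ hσ'
  refine ⟨N₀, fun N hN z hz => ?_⟩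
  have h0 : ∀ (x : T3) (i : Fin (N + 1)), 0 ≤ wgtC N φ z x i := fun x i => hadm.2.1 N _
  have hMi : (0 : ℝ) ≤ ((N + 1 : ℕ) : ℝ)⁻¹ := inv_nonneg.2 (Nat.cast_nonneg _)
  have hwI : ∀ i, Integrable fun x => wgtC N φ z x i := fun i =>
    PastDamping.integrable_of_continuous_T3 (FreeStretch.continuous_wgtC (hadm.1 N).continuous z i)
  have hwi : ∀ i, ∫ x, wgtC N φ z x i = 1 := fun i => by
    show ∫ x, φ N ((z i).1 - x) = 1
    rw [PastDamping.integral_comp_sub_left (φ N) (z i).1]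
    exact hadm.2.2.1 N
  -- the velocity factors (constant in `x`)
  set b : Fin (N + 1) → ℝ := fun i =>
    36 * ‖(z i).2 - cvel N ψ z i‖ ^ 4 + 3 * ‖(z i).2 - cvel N ψ z i‖ ^ 6 with hb
  have hb0 : ∀ i, 0 ≤ b i := fun i => by rw [hb]; positivity
  -- pointwise domination by an integrable majorant (density cap inserted)
  have hdom : ∀ x, cellA N φ ψ z x ≤ 27 * C / σ ^ 3 * (((N + 1 : ℕ) : ℝ)⁻¹ * ∑ i, wgtC N φ z x i * b i) := by
    intro x
    have hEx : 0 ≤ ((N + 1 : ℕ) : ℝ)⁻¹ * ∑ i, wgtC N φ z x i * b i :=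
      mul_nonneg hMi (Finset.sum_nonneg fun i _ => mul_nonneg (h0 x i) (hb0 i))
    exact (cellA_le (hadm.2.1 N) ψ z x).trans (mul_le_mul_of_nonneg_right (hN₀ N hN z hz x) hEx)
  have hgI : Integrable fun x => 27 * C / σ ^ 3 * (((N + 1 : ℕ) : ℝ)⁻¹ * ∑ i, wgtC N φ z x i * b i) :=
    ((integrable_finsetSum Finset.univ fun i _ => (hwI i).mul_const (b i)).const_mul _).const_mul _
  have hnn : ∀ x, 0 ≤ cellA N φ ψ z x := fun x => by unfold cellA; positivity
  calc ∫ x, cellA N φ ψ z x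
      ≤ ∫ x, 27 * C / σ ^ 3 * (((N + 1 : ℕ) : ℝ)⁻¹ * ∑ i, wgtC N φ z x i * b i) :=
        integral_mono_of_nonneg (Eventually.of_forall hnn) hgI (Eventually.of_forall hdom)
    _ = 27 * C / σ ^ 3 * (((N + 1 : ℕ) : ℝ)⁻¹ * ∑ i, b i) := by
        rw [integral_const_mul, integral_const_mul,
          integral_finsetSum Finset.univ fun i _ => (hwI i).mul_const (b i)]
        simp only [integral_mul_const, hwi, one_mul]

/-! ## The velocity factors -/

/-- `‖v − c‖^p ≤ 2^{p−1} (‖v‖^p + ‖c‖^p)`. -/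
theorem norm_sub_pow_le (v c : V3) (p : ℕ) : ‖v - c‖ ^ p ≤ 2 ^ (p - 1) * (‖v‖ ^ p + ‖c‖ ^ p) :=
  (pow_le_pow_left₀ (norm_nonneg _) (norm_sub_le v c) p).trans (add_pow_le (norm_nonneg _) (norm_nonneg _) p)

/-- `t⁴ ≤ 1 + t⁶` (`1 + t⁶ − t⁴ = (1 − t²)²(1 + t²) + t²`). -/
theorem pow_four_le_one_add_pow_six (t : ℝ) : t ^ 4 ≤ 1 + t ^ 6 := by
  nlinarith [mul_nonneg (sq_nonneg (1 - t ^ 2)) (by positivity : (0 : ℝ) ≤ 1 + t ^ 2), sq_nonneg t]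

/-- THE VELOCITY FACTORS: if `Σ_i ‖c_i‖^p ≤ Kcol Σ_j ‖v_j‖^p` for `p = 4, 6` (the covering bound), then
`Σ_i (36‖v_i − c_i‖⁴ + 3‖v_i − c_i‖⁶) ≤ 384 (1 + Kcol) Σ_j (1 + ‖v_j‖⁶)`. -/
theorem sum_moments_le {n : ℕ} (v c : Fin n → V3) {Kcol : ℝ} (hK : 0 ≤ Kcol)
    (h4 : ∑ i, ‖c i‖ ^ 4 ≤ Kcol * ∑ j, ‖v j‖ ^ 4) (h6 : ∑ i, ‖c i‖ ^ 6 ≤ Kcol * ∑ j, ‖v j‖ ^ 6) :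
    ∑ i, (36 * ‖v i - c i‖ ^ 4 + 3 * ‖v i - c i‖ ^ 6) ≤ 384 * (1 + Kcol) * ∑ j, (1 + ‖v j‖ ^ 6) := by
  have hv4 : ∑ j, ‖v j‖ ^ 4 ≤ ∑ j, (1 + ‖v j‖ ^ 6) :=
    Finset.sum_le_sum fun j _ => pow_four_le_one_add_pow_six _
  have hv6 : ∑ j, ‖v j‖ ^ 6 ≤ ∑ j, (1 + ‖v j‖ ^ 6) :=
    Finset.sum_le_sum fun j _ => le_add_of_nonneg_left zero_le_one
  have hstep : ∑ i, (36 * ‖v i - c i‖ ^ 4 + 3 * ‖v i - c i‖ ^ 6) ≤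
      ∑ i, (288 * (‖v i‖ ^ 4 + ‖c i‖ ^ 4) + 96 * (‖v i‖ ^ 6 + ‖c i‖ ^ 6)) := by
    refine Finset.sum_le_sum fun i _ => add_le_add ?_ ?_
    · have h := norm_sub_pow_le (v i) (c i) 4
      rw [show (2 : ℝ) ^ (4 - 1) = 8 by norm_num] at h
      linarith
    · have h := norm_sub_pow_le (v i) (c i) 6
      rw [show (2 : ℝ) ^ (6 - 1) = 32 by norm_num] at h
      linarith
  have hsplit : ∑ i, (288 * (‖v i‖ ^ 4 + ‖c i‖ ^ 4) + 96 * (‖v i‖ ^ 6 + ‖c i‖ ^ 6)) =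
      288 * (∑ i, ‖v i‖ ^ 4 + ∑ i, ‖c i‖ ^ 4) + 96 * (∑ i, ‖v i‖ ^ 6 + ∑ i, ‖c i‖ ^ 6) := by
    rw [Finset.sum_add_distrib, ← Finset.mul_sum, ← Finset.mul_sum, Finset.sum_add_distrib,
      Finset.sum_add_distrib]
  rw [hsplit] at hstep
  have hK4 := mul_le_mul_of_nonneg_left hv4 hK
  have hK6 := mul_le_mul_of_nonneg_left hv6 hK
  linarith

/-! ## The threshold of the cell radius -/

/-- For a cell kernel family, eventually `ℓ_N ≤ 1/4` (`ℓ_N ≤ ℓ_N (N+1)^{1/6} → 0`). -/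
theorem eventually_ell_le {ψ : ℕ → T3 → ℝ} {ℓ : ℕ → ℝ} (hcell : CellKernel ψ ℓ) :
    ∃ N₁ : ℕ, ∀ N : ℕ, N₁ ≤ N → ℓ N ≤ 1 / 4 := by
  obtain ⟨-, -, -, hℓ, -, -, -, hlim, -⟩ := hcell
  obtain ⟨N₁, hN₁⟩ := Filter.eventually_atTop.1 ((tendsto_order.1 hlim).2 (1 / 4) (by norm_num))
  refine ⟨N₁, fun N hN => ?_⟩
  have hM1 : (1 : ℝ) ≤ ((N + 1 : ℕ) : ℝ) := by exact_mod_cast Nat.succ_pos N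
  have h1 : 1 ≤ ((N + 1 : ℕ) : ℝ) ^ ((1 : ℝ) / 6) := Real.one_le_rpow hM1 (by norm_num)
  have h2 : ℓ N ≤ ℓ N * ((N + 1 : ℕ) : ℝ) ^ ((1 : ℝ) / 6) := le_mul_of_one_le_right (hℓ N).le h1
  exact h2.trans (hN₁ N hN).le

end CellUI

open CellUI in
/-- STUB 4a (the uniform-integrability input of the reshaped window stub). For every admissible block kernel
family `φ`, every cell kernel family `ψ` and every `0 < σ < 1/2`: `CellUIBound φ ψ σ`, i.e. there are `K₁`, `N₀`
with `∫ₓ cellA(z, x) dx ≤ K₁ · (N+1)⁻¹ Σ_j (1 + ‖v_j‖⁶)` for all `N ≥ N₀` and all `z` in the hard-sphere domain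
(`K₁ = (27C/σ³) · 384 (1 + Kcol)`: weighted Cauchy–Schwarz over each block, the hard-core density cap
`TimeZero.density_cap`, `∫ₓ φ_N(x_i − x) dx = 1`, and the covering bound `CellUI.sum_norm_cvel_pow_le` for the
cell velocities). -/
theorem stub_cellUI : ∀ (γ C : ℝ) (φ : ℕ → T3 → ℝ), 0 < γ → γ ≤ 1 / 15 → AdmissibleKernel γ C φ →
    ∀ (ψ : ℕ → T3 → ℝ) (ℓ : ℕ → ℝ), CellKernel ψ ℓ → ∀ σ : ℝ, 0 < σ → σ < 2⁻¹ → CellUIBound φ ψ σ := by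
  intro γ C φ hγ hγ' hadm ψ ℓ hcell σ hσ hσ'
  obtain ⟨Kcol, hK0, hcov⟩ := sum_norm_cvel_pow_le hcell
  obtain ⟨N₁, hN₁⟩ := eventually_ell_le hcell
  obtain ⟨N₀, hN₀⟩ := integral_cellA_le hadm hγ hγ' hσ hσ' ψ
  have hC0 : 0 ≤ C := Pointwise.admissible_C_nonneg hadm
  have hρ : 0 ≤ 27 * C / σ ^ 3 := by positivity
  refine ⟨27 * C / σ ^ 3 * (384 * (1 + Kcol)), max N₀ N₁, fun N hN z hz => ?_⟩
  have hNN₀ : N₀ ≤ N := (le_max_left _ _).trans hN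
  have hℓN : ℓ N ≤ 1 / 4 := hN₁ N ((le_max_right _ _).trans hN)
  have hMi : (0 : ℝ) ≤ ((N + 1 : ℕ) : ℝ)⁻¹ := inv_nonneg.2 (Nat.cast_nonneg _)
  have hb : ∑ i, (36 * ‖(z i).2 - cvel N ψ z i‖ ^ 4 + 3 * ‖(z i).2 - cvel N ψ z i‖ ^ 6) ≤
      384 * (1 + Kcol) * ∑ j, (1 + ‖(z j).2‖ ^ 6) :=
    sum_moments_le (fun i => (z i).2) (fun i => cvel N ψ z i) hK0 (hcov N hℓN z 4) (hcov N hℓN z 6)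
  calc ∫ x, cellA N φ ψ z x ≤ 27 * C / σ ^ 3 * (((N + 1 : ℕ) : ℝ)⁻¹ *
          ∑ i, (36 * ‖(z i).2 - cvel N ψ z i‖ ^ 4 + 3 * ‖(z i).2 - cvel N ψ z i‖ ^ 6)) := hN₀ N hNN₀ z hz
    _ ≤ 27 * C / σ ^ 3 * (((N + 1 : ℕ) : ℝ)⁻¹ * (384 * (1 + Kcol) * ∑ j, (1 + ‖(z j).2‖ ^ 6))) :=
        mul_le_mul_of_nonneg_left (mul_le_mul_of_nonneg_left hb hMi) hρ
    _ = 27 * C / σ ^ 3 * (384 * (1 + Kcol)) * (((N + 1 : ℕ) : ℝ)⁻¹ * ∑ j, (1 + ‖(z j).2‖ ^ 6)) := by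
        ring

end

end Summit.AtomisticToContinuum.HydrodynamicLimit.Theorems.SustainedAnisotropy
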